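import Summits.Ventures.Crystal3D.Theorems.StickyWulffConstantCoaxialWallLawOnSiteBridge
import Summits.Ventures.Crystal3D.Theorems.StickyWulffConstantCoaxialWallLawMenuWindowFrames
import HarnessLib

/-!
# The on-site DOMINATION under the abstract neighbour menu, I: frame lemma, collapse, translation systems
# (crux `CoaxialWallLaw`, stmt-Ventures-19481, line `WallLedgerF`; re-base of `…BarlowWindowFrames` / `…OnSiteDominate` for 𝒰_cx)

HONEST FRAMING. Venture `Summits/Ventures/Crystal3D` (cell `crystal3d-full`), helper `--supports` the crux
`CoaxialWallLaw` (stmt-Ventures-19481, `route-Ventures-StickyWulffConstant`), REGISTERED line `WallLedgerF` (planner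
cf-p1, decision (lxii): the non-Barlow coaxial universe of record is the COAXIAL-MODULE universe 𝒰_cx
= `coaxialModuleUniverse`).  Rung credit; F-C1 not moved; census-free.

`…BarlowWindowFrames` and `…OnSiteDominate` use the Barlow stacking ONLY through the NEIGHBOUR MENU: every occupied
unit offset of a reader `q` lies in `D₊ ∪ D₋ = fccSlots ∪ basalMirror '' fccSlots`.  `…MenuWindowFrames` and this file re-prove them under
exactly that hypothesis — a set `W ∋` the radius-`3` window with
`hW : ∀ q x ∈ W, dist q x = 1 → x − q ∈ fccSlots ∨ x − q ∈ basalMirror '' fccSlots` —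
so that they apply verbatim to COAXIAL-MODULE windows (`W = coaxialModule 1 √(2/3)`, 19481-p1's
`coaxialModule_neighbour_mem`) as well as to Barlow windows (`W = Λ(s)`, `barlow_neighbour_mem`):
* `std_of_isEndPairA_menu`, **`dominate_of_collapse_menu`**, **`dominate_trans_menu`** (proofs = the landed ones);
* NEW packaging for the bridge: **`exists_transSig_bound_menu`** — at a window of `X` about the payer `z` congruent
  (`S`, `hagree`) to a pattern `P ⊆ W`, for ANY frame `L`:
  `∃ ε n, n ∈ modelNormals ∧ localSummandA v ⟨L, roots⟩ ⟨L, roots⟩ X z ≤ localStatSig P v (transSigs ε n) 0`.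
The twin systems are in part II (`…OnSiteDominateMenuTwin`).
WHAT THIS IS NOT: not the 𝒰_cx bridge/capstone (next files), not the tail; F-C1 not moved.
-/

noncomputable section

namespace Summit.Ventures.Crystal3D.Theorems

open Summit.Ventures.Crystal3D Finset
open Literature.MathematicalPhysics.StatisticalMechanics (basalMirror basalMirror_apply_coord basalMirror_basalMirror)
open scoped InnerProductSpace



section Dominate

variable {v : WordVersion} {Y : Finset (EuclideanSpace ℝ (Fin 3))} {W : Set (EuclideanSpace ℝ (Fin 3))}


/-- At an (A)-end pair `(b, q)` with `|b| ≤ 1` of systems with slot roots, the mover `q` is a window site whose unit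
sphere lies on the stacking, so the frame lemma applies to its class frame. -/
theorem std_of_isEndPairA_menu (hW : ∀ q ∈ W, ∀ x ∈ W, dist q x = 1 →
      x - q ∈ fccSlots ∨ x - q ∈ (basalMirror : EuclideanSpace ℝ (Fin 3) → EuclideanSpace ℝ (Fin 3)) '' ↑fccSlots)
    (hY : ∀ x ∈ Y, dist (0 : EuclideanSpace ℝ (Fin 3)) x ≤ 3 → x ∈ W)
    {S₁ S₂ : PlateSystem} (hR₁ : S₁.RT ⊆ fccSlots) (hR₂ : S₂.RT ⊆ fccSlots)
    {b q : EuclideanSpace ℝ (Fin 3)} (hb : dist (0 : EuclideanSpace ℝ (Fin 3)) b ≤ 1) (h : IsEndPairA Y v S₁ S₂ b q)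
    {G : EuclideanSpace ℝ (Fin 3) ≃ₗᵢ[ℝ] EuclideanSpace ℝ (Fin 3)} {d : EuclideanSpace ℝ (Fin 3)}
    (hmove : IsEndMove Y v G d q b) :
    (G : EuclideanSpace ℝ (Fin 3) → EuclideanSpace ℝ (Fin 3)) '' ↑fccSlots = ↑fccSlots ∨
      (G : EuclideanSpace ℝ (Fin 3) → EuclideanSpace ℝ (Fin 3)) '' ↑fccSlots =
        (basalMirror : EuclideanSpace ℝ (Fin 3) → EuclideanSpace ℝ (Fin 3)) '' ↑fccSlots := by
  have hbq : dist b q = 1 := dist_eq_one_of_isEndPair hR₁ hR₂ (isEndPair_of_isEndPairA h)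
  have hq : q ∈ Y := h.1
  have hq2 : dist (0 : EuclideanSpace ℝ (Fin 3)) q ≤ 2 := by linarith [dist_triangle (0 : EuclideanSpace ℝ (Fin 3)) b q]
  refine frame_of_isEndMove_menu (fun x hx hqx => hW q (hY q hq (by linarith)) x (hY x hx ?_) hqx) hmove
  linarith [dist_triangle (0 : EuclideanSpace ℝ (Fin 3)) q x]

/-- **DOMINATION FROM A SHARED COLLAPSE DATUM.**  See the module docstring. -/
theorem dominate_of_collapse_menu (hW : ∀ q ∈ W, ∀ x ∈ W, dist q x = 1 →
      x - q ∈ fccSlots ∨ x - q ∈ (basalMirror : EuclideanSpace ℝ (Fin 3) → EuclideanSpace ℝ (Fin 3)) '' ↑fccSlots)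
    (hY : ∀ x ∈ Y, dist (0 : EuclideanSpace ℝ (Fin 3)) x ≤ 3 → x ∈ W)
    (S₁ S₂ : PlateSystem) (hR₁ : S₁.RT ⊆ basalHexagon) (hR₂ : S₂.RT ⊆ basalHexagon)
    (ε : Bool) (F : EuclideanSpace ℝ (Fin 3) ≃ₗᵢ[ℝ] EuclideanSpace ℝ (Fin 3)) (σ : ℝ) (hσ : σ = 1 ∨ σ = -1)
    (hF : (F : EuclideanSpace ℝ (Fin 3) → EuclideanSpace ℝ (Fin 3)) '' ↑fccSlots =
      (sigFrame ε : EuclideanSpace ℝ (Fin 3) → EuclideanSpace ℝ (Fin 3)) '' ↑fccSlots)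
    (hcol : ∀ S : PlateSystem, (S = S₁ ∨ S = S₂) → ∀ r ∈ S.RT, ∀ κ : List (EuclideanSpace ℝ (Fin 3)), WFChain r κ →
      ((S.Fw κ : EuclideanSpace ℝ (Fin 3) → EuclideanSpace ℝ (Fin 3)) '' ↑fccSlots = ↑fccSlots ∨
        (S.Fw κ : EuclideanSpace ℝ (Fin 3) → EuclideanSpace ℝ (Fin 3)) '' ↑fccSlots =
          (basalMirror : EuclideanSpace ℝ (Fin 3) → EuclideanSpace ℝ (Fin 3)) '' ↑fccSlots) →
      ((S.Fw κ : EuclideanSpace ℝ (Fin 3) → EuclideanSpace ℝ (Fin 3)) '' ↑fccSlots =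
          (F : EuclideanSpace ℝ (Fin 3) → EuclideanSpace ℝ (Fin 3)) '' ↑fccSlots ∧
        S.Fw κ (((-1 : ℝ) ^ κ.length) • r) = σ • F r) ∨
      ((S.Fw κ : EuclideanSpace ℝ (Fin 3) → EuclideanSpace ℝ (Fin 3)) '' ↑fccSlots =
          (basalMirror : EuclideanSpace ℝ (Fin 3) → EuclideanSpace ℝ (Fin 3)) ''
            ((F : EuclideanSpace ℝ (Fin 3) → EuclideanSpace ℝ (Fin 3)) '' ↑fccSlots) ∧
        S.Fw κ (((-1 : ℝ) ^ κ.length) • r) = -basalMirror (σ • F r) ∧ (F r) 2 ≠ 0)) :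
    ∃ n ∈ modelNormals, ∀ b q : EuclideanSpace ℝ (Fin 3), dist (0 : EuclideanSpace ℝ (Fin 3)) b ≤ 1 →
      IsEndPairA Y v S₁ S₂ b q → IsEndPairSig Y v (transSigs ε n) b q := by
  classical
  set e₃ : EuclideanSpace ℝ (Fin 3) := EuclideanSpace.single (2 : Fin 3) (1 : ℝ) with he₃
  -- involution facts of the standard frame
  have hinv : ∀ x, sigFrame ε (sigFrame ε x) = x := by
    intro x; conv_lhs => rw [← sigFrame_symm_apply ε (sigFrame ε x)]; exact (sigFrame ε).symm_apply_apply x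
  have hadj : ∀ x y, ⟪sigFrame ε x, y⟫_ℝ = ⟪x, sigFrame ε y⟫_ℝ := by
    intro x y; rw [← LinearIsometryEquiv.inner_map_map (sigFrame ε) x (sigFrame ε y), hinv]
  -- every vector of `img F` is a standard-frame slot image
  have hpull : ∀ y ∈ (F : EuclideanSpace ℝ (Fin 3) → EuclideanSpace ℝ (Fin 3)) '' ↑fccSlots, sigFrame ε y ∈ fccSlots := by
    intro y hy
    rw [hF] at hy
    obtain ⟨w₀, hw₀, rfl⟩ := hy
    rw [hinv]; exact mem_coe.1 hw₀
  -- the row plane normal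
  set n : EuclideanSpace ℝ (Fin 3) := sigFrame ε (F e₃) with hn
  have hn1 : ‖n‖ = 1 := by rw [hn, LinearIsometryEquiv.norm_map, LinearIsometryEquiv.norm_map, he₃, PiLp.norm_single, norm_one]
  have hnmenu : ∀ w ∈ fccSlots, ⟪w, n⟫_ℝ = 0 ∨ ⟪w, n⟫_ℝ = Real.sqrt (2 / 3) ∨ ⟪w, n⟫_ℝ = -Real.sqrt (2 / 3) := by
    intro w hw
    have hmem : sigFrame ε w ∈ (F : EuclideanSpace ℝ (Fin 3) → EuclideanSpace ℝ (Fin 3)) '' ↑fccSlots := by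
      rw [hF]; exact ⟨w, mem_coe.2 hw, rfl⟩
    obtain ⟨w', hw', heq⟩ := hmem
    rw [hn, ← hadj, ← heq, LinearIsometryEquiv.inner_map_map, inner_single_two_one]
    exact slot_apply_two_cases (mem_coe.1 hw')
  refine ⟨n, mem_modelNormals_of_menu hn1 hnmenu, ?_⟩
  intro b q hb hpair
  have hR₁s : S₁.RT ⊆ fccSlots := fun r hr => (mem_filter.1 (hR₁ hr)).1
  have hR₂s : S₂.RT ⊆ fccSlots := fun r hr => (mem_filter.1 (hR₂ hr)).1
  obtain ⟨hq, hbY, hpay, G, d, hadm, hqd, hmove⟩ := hpair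
  have hstd := std_of_isEndPairA_menu hW hY hR₁s hR₂s hb ⟨hq, hbY, hpay, G, d, hadm, hqd, hmove⟩ hmove
  -- the class datum, from whichever system
  obtain ⟨S, hS, hRS, hadmS⟩ : ∃ S : PlateSystem, (S = S₁ ∨ S = S₂) ∧ S.RT ⊆ basalHexagon ∧ S.Adm G d := by
    rcases hadm with h | h
    · exact ⟨S₁, Or.inl rfl, hR₁, h⟩
    · exact ⟨S₂, Or.inr rfl, hR₂, h⟩
  obtain ⟨r, hr, κ, hκ, hG, hd⟩ := hadmS
  obtain ⟨hrS, hr2⟩ := mem_filter.1 (hRS hr)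
  have hσr : σ • r ∈ fccSlots := by
    rcases hσ with rfl | rfl
    · rw [one_smul]; exact hrS
    · rw [neg_one_smul]; exact neg_mem_fccSlots hrS
  -- the signature slot `w` with `sigFrame ε w = σ F r`
  set w : EuclideanSpace ℝ (Fin 3) := sigFrame ε (σ • F r) with hw
  have hwS : w ∈ fccSlots := hpull _ ⟨σ • r, mem_coe.2 hσr, by rw [LinearIsometryEquiv.map_smul]⟩
  have hwn : ⟪w, n⟫_ℝ = 0 := by
    rw [hw, hn, ← hadj, hinv, real_inner_smul_left, LinearIsometryEquiv.inner_map_map, inner_single_two_one, hr2, mul_zero]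
  have hwplane : w ∈ planeHexagon n := mem_filter.2 ⟨hwS, hwn⟩
  have hdirw : sigFrame ε w = σ • F r := by rw [hw, hinv]
  rcases hcol S hS r hr κ hκ (by rw [← hG]; exact hstd) with ⟨hI, hdir⟩ | ⟨hII, hdir, hcross⟩
  · -- type I: signature `(ε, w)`
    have himg : (G : EuclideanSpace ℝ (Fin 3) → EuclideanSpace ℝ (Fin 3)) '' ↑fccSlots =
        (sigFrame ε : EuclideanSpace ℝ (Fin 3) → EuclideanSpace ℝ (Fin 3)) '' ↑fccSlots := by rw [hG, hI, hF]
    have hdd : sigDir (ε, w) = d := by rw [sigDir, hdirw, ← hdir, ← hd]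
    refine ⟨hq, hbY, hpay, (ε, w), mem_union_left _ (mem_image.2 ⟨w, hwplane, rfl⟩), by rw [hdd]; exact hqd, ?_⟩
    rw [hdd]
    exact (isEndMove_congr himg v d q b).1 hmove
  · -- type II: signature `(¬ε, −w)`
    have himg : (G : EuclideanSpace ℝ (Fin 3) → EuclideanSpace ℝ (Fin 3)) '' ↑fccSlots =
        (sigFrame (!ε) : EuclideanSpace ℝ (Fin 3) → EuclideanSpace ℝ (Fin 3)) '' ↑fccSlots := by
      rw [hG, hII, hF, image_sigFrame_not]
    have hw2 : (-w) 2 ≠ 0 := by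
      intro h0
      have h0' : w 2 = 0 := by
        have : (-w) 2 = -(w 2) := rfl
        rw [this] at h0; linarith
      rw [hw, sigFrame_apply_two_eq_zero_iff] at h0'
      have : (σ • F r) 2 = σ * (F r) 2 := rfl
      rw [this] at h0'
      rcases hσ with rfl | rfl
      · exact hcross (by linarith)
      · exact hcross (by linarith)
    have hdd : sigDir (!ε, -w) = d := by
      rw [sigDir]
      change sigFrame (!ε) (-w) = d
      rw [map_neg, sigFrame_not_apply, hdirw, ← hdir, ← hd]
    refine ⟨hq, hbY, hpay, (!ε, -w), mem_union_right _ (mem_image.2 ⟨-w, mem_filter.2 ⟨mem_filter.2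
      ⟨neg_mem_fccSlots hwS, by rw [inner_neg_left, hwn, neg_zero]⟩, hw2⟩, rfl⟩), by rw [hdd]; exact hqd, ?_⟩
    rw [hdd]
    exact (isEndMove_congr himg v d q b).1 hmove

/-- **DOMINATION FOR ROOT-ONLY TWIN SYSTEMS.**  See the module docstring. -/
theorem dominate_trans_menu (hW : ∀ q ∈ W, ∀ x ∈ W, dist q x = 1 →
      x - q ∈ fccSlots ∨ x - q ∈ (basalMirror : EuclideanSpace ℝ (Fin 3) → EuclideanSpace ℝ (Fin 3)) '' ↑fccSlots)
    (hY : ∀ x ∈ Y, dist (0 : EuclideanSpace ℝ (Fin 3)) x ≤ 3 → x ∈ W)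
    (L' : EuclideanSpace ℝ (Fin 3) ≃ₗᵢ[ℝ] EuclideanSpace ℝ (Fin 3)) (R₁ R₂ : Finset (EuclideanSpace ℝ (Fin 3)))
    (hR₁ : R₁ ⊆ basalHexagon) (hR₂ : R₂ ⊆ basalHexagon) :
    ∃ ε : Bool, ∃ n ∈ modelNormals, ∀ b q : EuclideanSpace ℝ (Fin 3), dist (0 : EuclideanSpace ℝ (Fin 3)) b ≤ 1 →
      IsEndPairA Y v ⟨L', R₁⟩ ⟨L', R₂⟩ b q → IsEndPairSig Y v (transSigs ε n) b q := by
  classical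
  obtain ⟨F, σ, hσ, hFstd, hcol⟩ := class_collapse ⟨L', R₁ ∪ R₂⟩
  obtain ⟨ε, hF⟩ := exists_sigFrame_of_std hFstd
  have h₁ : ∀ κ, (⟨L', R₁⟩ : PlateSystem).Fw κ = (⟨L', R₁ ∪ R₂⟩ : PlateSystem).Fw κ := PlateSystem.fw_eq_of_G₀ rfl
  have h₂ : ∀ κ, (⟨L', R₂⟩ : PlateSystem).Fw κ = (⟨L', R₁ ∪ R₂⟩ : PlateSystem).Fw κ := PlateSystem.fw_eq_of_G₀ rfl
  obtain ⟨n, hn, hdom⟩ := dominate_of_collapse_menu hW hY ⟨L', R₁⟩ ⟨L', R₂⟩ hR₁ hR₂ ε F σ hσ hF (by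
    rintro S (rfl | rfl) r hr κ hκ hstd
    · rw [h₁] at hstd ⊢
      exact hcol r (mem_union_left _ hr) κ hκ hstd
    · rw [h₂] at hstd ⊢
      exact hcol r (mem_union_right _ hr) κ hκ hstd)
  exact ⟨ε, n, hn, hdom⟩

end Dominate

/-! ### Packaging for the bridge -/

open scoped Classical in
/-- **Translation-row bound at a menu window.**  If the radius-`3` window of `X` about the payer `z` is carried by the
motion `x ↦ S⁻¹x − S⁻¹z` onto a pattern `P ⊆ W`, then for every frame `L` some signature row `transSigs ε n` bounds
the typed translation summand: `localSummandA ≤ localStatSig P v (transSigs ε n) 0`. -/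
theorem exists_transSig_bound_menu {v : WordVersion} {W : Set (EuclideanSpace ℝ (Fin 3))}
    (hW : ∀ q ∈ W, ∀ x ∈ W, dist q x = 1 →
      x - q ∈ fccSlots ∨ x - q ∈ (basalMirror : EuclideanSpace ℝ (Fin 3) → EuclideanSpace ℝ (Fin 3)) '' ↑fccSlots)
    {X P : Finset (EuclideanSpace ℝ (Fin 3))} {z : EuclideanSpace ℝ (Fin 3)}
    (S : EuclideanSpace ℝ (Fin 3) ≃ₗᵢ[ℝ] EuclideanSpace ℝ (Fin 3))
    (hagree : ∀ y, dist (0 : EuclideanSpace ℝ (Fin 3)) y ≤ 3 → (y ∈ X.image (fun x => S.symm x + -S.symm z) ↔ y ∈ P))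
    (hPW : ∀ p ∈ P, p ∈ W) (L : EuclideanSpace ℝ (Fin 3) ≃ₗᵢ[ℝ] EuclideanSpace ℝ (Fin 3)) :
    ∃ ε : Bool, ∃ n ∈ modelNormals,
      localSummandA v ⟨L, inPlaneRoots L 1⟩ ⟨L, inPlaneRoots L (-1)⟩ X z ≤ localStatSig P v (transSigs ε n) 0 := by
  have hYW : ∀ x ∈ X.image (fun x => S.symm x + -S.symm z), dist (0 : EuclideanSpace ℝ (Fin 3)) x ≤ 3 → x ∈ W :=
    fun x hx hd => hPW x ((hagree x hd).1 hx)
  obtain ⟨ε, n, hn, hdom⟩ := dominate_trans_menu (v := v) hW hYW (L.trans S.symm) (inPlaneRoots L 1)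
    (inPlaneRoots L (-1)) (inPlaneRoots_subset_basalHexagon L 1) (inPlaneRoots_subset_basalHexagon L (-1))
  exact ⟨ε, n, hn, localSummandA_le_localStatSig_window S hagree L L _ _ (transSigs_slots ε n) hdom⟩

end Summit.Ventures.Crystal3D.Theorems

end
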